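import Mathlib
import Literature.MathematicalPhysics.StatisticalMechanics.LocalMatchingCompactness
import Summits.AtomisticToContinuum.Crystallization.Theorems.IsometryAtomsMinimisingLawsCohesiveMeasurableClassAux1

/-!
# Finite nets of `O(3)` and approximate matching events — helper 2 for stub `stub_measurableClass`
# (line `purity_stacking`, crux `IsometryAtoms.MinimisingLawsCohesive`, stmt-AtomisticToContinuum-15777)

The stub says that for a `δ`-separated `W ⊆ ℝ³` the rooted congruence class
`K := {count|A(W) : A a linear isometry of ℝ³}` is Giry-measurable.  The proof writes
`K = HardCore δ ∩ ⋂ₙ ⋃ₘ Eₙ(Dₘ)`, where `HardCore δ` is the (measurable, helper 1) hard-core class,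
`D : ℕ → O(3)` is a dense sequence of linear isometries and `Eₙ(B)` is the *approximate matching event*
"every `B w` (`w ∈ W`, `‖w‖ ≤ n + 1`) has a point of the configuration within `εₙ := δ/(n+4)`, and the
configuration has no point in `closedBall 0 n` off these small balls".  This file provides:

* `exists_isometrySeq` / anchor `measurableClass_isometrySeq` — a sequence `D` of linear isometries of a
  finite-dimensional real normed space which is dense in operator norm among linear isometries and along
  which every sequence of indices has an operator-norm convergent subsequence with isometric limit
  (the isometries form a compact subset of `E →L[ℝ] E`);
* `measurableSet_event` — the events `Eₙ(B)` are measurable;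
* `count_restrict_image_mem_event` — (`K ⊆ …`) `count|A(W) ∈ Eₙ(Dₘ)` as soon as `Dₘ` is
  `εₙ/(n+2)`-close to `A`;
* `eq_image_of_matching` — (`… ⊆ K`, geometric core) if `S`, `W` are `δ`-separated, `g ∘ φ → A`
  pointwise-uniformly on bounded sets, and for every `n` the configuration `S` and the points `gₙ w`
  match as in `Eₙ(gₙ)`, then `S = A(W)` (limits of eventually constant sequences in separated sets, and
  finiteness of bounded parts of `W`).
-/

noncomputable section

open MeasureTheory Metric Filter Topology
open scoped ENNReal

namespace Summit.AtomisticToContinuum.Crystallization.Theorems.IsometryAtomsMinimisingLawsCohesive.MeasurableClass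

open Literature.MathematicalPhysics.StatisticalMechanics (finite_of_forall_le_dist_of_subset_closedBall)

/-! ## A dense sequence in the compact group of linear isometries -/

/-- **Finite nets of the isometry group.**  In a finite-dimensional real normed space `E` there is a
sequence `D` of linear isometries such that (i) every linear isometry is approximated by some `D m` in
operator norm, and (ii) along every sequence of indices `g`, a subsequence of `D ∘ g` converges in
operator norm to a linear isometry.  (The linear isometries form a closed bounded, hence compact, subset
of `E →L[ℝ] E`; take a dense sequence of this compact metric space.) -/
theorem exists_isometrySeq (E : Type*) [NormedAddCommGroup E] [NormedSpace ℝ E]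
    [FiniteDimensional ℝ E] :
    ∃ D : ℕ → (E →ₗᵢ[ℝ] E),
      (∀ A : E →ₗᵢ[ℝ] E, ∀ η : ℝ, 0 < η → ∃ m : ℕ, ∀ x, ‖D m x - A x‖ ≤ η * ‖x‖) ∧
      (∀ g : ℕ → ℕ, ∃ A : E →ₗᵢ[ℝ] E, ∃ φ : ℕ → ℕ, StrictMono φ ∧
        ∀ η : ℝ, 0 < η → ∀ᶠ k in atTop, ∀ x, ‖D (g (φ k)) x - A x‖ ≤ η * ‖x‖) := by
  set Iso : Set (E →L[ℝ] E) := {f | ∀ x, ‖f x‖ = ‖x‖} with hIso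
  have hclosed : IsClosed Iso := by
    have : Iso = ⋂ x, {f : E →L[ℝ] E | ‖f x‖ = ‖x‖} := by
      ext f
      simp [hIso]
    rw [this]
    exact isClosed_iInter fun x =>
      isClosed_eq (ContinuousLinearMap.apply ℝ E x).continuous.norm continuous_const
  have hbdd : Bornology.IsBounded Iso := by
    refine (Metric.isBounded_closedBall (x := (0 : E →L[ℝ] E)) (r := 1)).subset fun f hf => ?_
    rw [mem_closedBall, dist_zero_right]
    exact ContinuousLinearMap.opNorm_le_bound f zero_le_one fun x => by rw [hf x, one_mul]
  have hcpt : IsCompact Iso := Metric.isCompact_of_isClosed_isBounded hclosed hbdd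
  have hone : (1 : E →L[ℝ] E) ∈ Iso := fun x => rfl
  haveI : Nonempty Iso := ⟨⟨1, hone⟩⟩
  have hdense : DenseRange (TopologicalSpace.denseSeq Iso) := TopologicalSpace.denseRange_denseSeq Iso
  set D' := TopologicalSpace.denseSeq Iso with hD'
  -- operator-norm closeness gives pointwise closeness
  have hpt : ∀ f f' : E →L[ℝ] E, ∀ η : ℝ, dist f f' < η → ∀ x, ‖f x - f' x‖ ≤ η * ‖x‖ := by
    intro f f' η h x
    rw [dist_eq_norm] at h
    calc ‖f x - f' x‖ = ‖(f - f') x‖ := by simp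
      _ ≤ ‖f - f'‖ * ‖x‖ := ContinuousLinearMap.le_opNorm _ _
      _ ≤ η * ‖x‖ := mul_le_mul_of_nonneg_right h.le (norm_nonneg _)
  refine ⟨fun m => ⟨((D' m : E →L[ℝ] E) : E →ₗ[ℝ] E), (D' m).2⟩, ?_, ?_⟩
  · intro A η hη
    have hA : A.toContinuousLinearMap ∈ Iso := fun x => by simp
    obtain ⟨m, hm⟩ := Metric.denseRange_iff.1 hdense ⟨_, hA⟩ η hη
    refine ⟨m, fun x => ?_⟩
    have := hpt (D' m : E →L[ℝ] E) A.toContinuousLinearMap η (by rwa [dist_comm] at hm) x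
    simpa using this
  · intro g
    obtain ⟨f₀, hf₀, φ, hφ, hlim⟩ := hcpt.tendsto_subseq (x := fun n => (D' (g n) : E →L[ℝ] E))
      fun n => (D' (g n)).2
    refine ⟨⟨(f₀ : E →ₗ[ℝ] E), hf₀⟩, φ, hφ, fun η hη => ?_⟩
    obtain ⟨N, hN⟩ := Metric.tendsto_atTop.1 hlim η hη
    refine eventually_atTop.2 ⟨N, fun k hk x => ?_⟩
    have := hpt (D' (g (φ k)) : E →L[ℝ] E) f₀ η (hN k hk) x
    simpa using this

/-- **Anchor of this helper file**: `exists_isometrySeq` for `ℝ³`. -/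
theorem measurableClass_isometrySeq :
    ∃ D : ℕ → (EuclideanSpace ℝ (Fin 3) →ₗᵢ[ℝ] EuclideanSpace ℝ (Fin 3)),
      (∀ A : EuclideanSpace ℝ (Fin 3) →ₗᵢ[ℝ] EuclideanSpace ℝ (Fin 3), ∀ η : ℝ, 0 < η →
        ∃ m : ℕ, ∀ x, ‖D m x - A x‖ ≤ η * ‖x‖) ∧
      (∀ g : ℕ → ℕ, ∃ A : EuclideanSpace ℝ (Fin 3) →ₗᵢ[ℝ] EuclideanSpace ℝ (Fin 3),
        ∃ φ : ℕ → ℕ, StrictMono φ ∧ ∀ η : ℝ, 0 < η →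
          ∀ᶠ k in Filter.atTop, ∀ x, ‖D (g (φ k)) x - A x‖ ≤ η * ‖x‖) := by
  exact exists_isometrySeq (EuclideanSpace ℝ (Fin 3))

/-! ## Separated sets: countability, images -/

/-- A `δ`-separated set (`δ > 0`) of `ℝ³` is countable (disjoint open balls in a separable space).
(Same statement as `MinimiserShells.Negative.Rootedness.countable_of_separated`; reproved to keep the
imports light.) -/
theorem countable_of_sep {δ : ℝ} (hδ : 0 < δ) {S : Set (EuclideanSpace ℝ (Fin 3))}
    (hsep : ∀ x ∈ S, ∀ y ∈ S, x ≠ y → δ ≤ dist x y) : S.Countable := by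
  -- adapted from Summits…MinimiserShells.Negative.Rootedness.countable_of_separated
  have hdisj : S.PairwiseDisjoint fun x => ball x (δ / 2) := by
    intro x hx y hy hxy
    refine Set.disjoint_left.2 fun z hzx hzy => ?_
    have h1 : dist z x < δ / 2 := mem_ball.1 hzx
    have h2 : dist z y < δ / 2 := mem_ball.1 hzy
    have h3 := hsep x hx y hy hxy
    linarith [dist_triangle_left x y z]
  exact hdisj.countable_of_isOpen (fun x _ => isOpen_ball)
    fun x _ => ⟨x, mem_ball_self (by linarith)⟩

/-- The image of a `δ`-separated set under a linear isometry is `δ`-separated. -/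
theorem sep_image {δ : ℝ} {W : Set (EuclideanSpace ℝ (Fin 3))}
    (hW : ∀ x ∈ W, ∀ y ∈ W, x ≠ y → δ ≤ dist x y)
    (A : EuclideanSpace ℝ (Fin 3) →ₗᵢ[ℝ] EuclideanSpace ℝ (Fin 3)) :
    ∀ x ∈ A '' W, ∀ y ∈ A '' W, x ≠ y → δ ≤ dist x y := by
  rintro _ ⟨x, hx, rfl⟩ _ ⟨y, hy, rfl⟩ hne
  rw [A.isometry.dist_eq]
  exact hW x hx y hy fun h => hne (by rw [h])

/-! ## The approximate matching events -/

/-- The approximate matching event `{μ | (∀ w ∈ W', μ (ball (f w) ε) ≠ 0) ∧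
μ (closedBall 0 R \ ⋃ w ∈ W', ball (f w) ε) = 0}` is Giry-measurable (`W'` countable). -/
theorem measurableSet_event {W' : Set (EuclideanSpace ℝ (Fin 3))} (hW' : W'.Countable)
    (f : EuclideanSpace ℝ (Fin 3) → EuclideanSpace ℝ (Fin 3)) (ε R : ℝ) :
    MeasurableSet {μ : Measure (EuclideanSpace ℝ (Fin 3)) | (∀ w ∈ W', μ (ball (f w) ε) ≠ 0) ∧
      μ (closedBall 0 R \ ⋃ w ∈ W', ball (f w) ε) = 0} := by
  have h1 : MeasurableSet {μ : Measure (EuclideanSpace ℝ (Fin 3)) | ∀ w ∈ W', μ (ball (f w) ε) ≠ 0} := by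
    have : {μ : Measure (EuclideanSpace ℝ (Fin 3)) | ∀ w ∈ W', μ (ball (f w) ε) ≠ 0} =
        ⋂ w ∈ W', {μ | μ (ball (f w) ε) = 0}ᶜ := by
      ext μ
      simp only [Set.mem_setOf_eq, Set.mem_iInter, Set.mem_compl_iff]
    rw [this]
    exact MeasurableSet.biInter hW' fun w _ =>
      (measurableSet_setOf_measure_eq measurableSet_ball 0).compl
  have hU : MeasurableSet (closedBall (0 : EuclideanSpace ℝ (Fin 3)) R \ ⋃ w ∈ W', ball (f w) ε) :=
    measurableSet_closedBall.diff (MeasurableSet.biUnion hW' fun w _ => measurableSet_ball)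
  exact h1.inter (measurableSet_setOf_measure_eq hU 0)

/-- **`K ⊆ ⋂ₙ ⋃ₘ Eₙ(Dₘ)`.**  If `W` is `δ`-separated (`δ > 0`), `A` is a linear isometry and the linear
isometry `B` is `δ/((n+4)(n+2))`-close to `A` in operator norm, then `count|A(W)` lies in the approximate
matching event `Eₙ(B)`. -/
theorem count_restrict_image_mem_event {δ : ℝ} (hδ : 0 < δ) {W : Set (EuclideanSpace ℝ (Fin 3))}
    (hW : ∀ x ∈ W, ∀ y ∈ W, x ≠ y → δ ≤ dist x y)
    (A B : EuclideanSpace ℝ (Fin 3) →ₗᵢ[ℝ] EuclideanSpace ℝ (Fin 3)) (n : ℕ)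
    (hB : ∀ x, ‖B x - A x‖ ≤ δ / ((n : ℝ) + 4) / ((n : ℝ) + 2) * ‖x‖) :
    (∀ w ∈ {w ∈ W | ‖w‖ ≤ (n : ℝ) + 1},
        (Measure.count : Measure (EuclideanSpace ℝ (Fin 3))).restrict (A '' W)
          (ball (B w) (δ / ((n : ℝ) + 4))) ≠ 0) ∧
      (Measure.count : Measure (EuclideanSpace ℝ (Fin 3))).restrict (A '' W)
        (closedBall 0 n \ ⋃ w ∈ {w ∈ W | ‖w‖ ≤ (n : ℝ) + 1}, ball (B w) (δ / ((n : ℝ) + 4))) = 0 := by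
  have hmeasAW : MeasurableSet (A '' W) := (countable_of_sep hδ (sep_image hW A)).measurableSet
  have hε : 0 < δ / ((n : ℝ) + 4) := by positivity
  have hclose : ∀ w : EuclideanSpace ℝ (Fin 3), ‖w‖ ≤ (n : ℝ) + 1 →
      dist (A w) (B w) < δ / ((n : ℝ) + 4) := by
    intro w hw
    rw [dist_comm, dist_eq_norm]
    calc ‖B w - A w‖ ≤ δ / ((n : ℝ) + 4) / ((n : ℝ) + 2) * ‖w‖ := hB w
      _ ≤ δ / ((n : ℝ) + 4) / ((n : ℝ) + 2) * ((n : ℝ) + 1) := by gcongr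
      _ < δ / ((n : ℝ) + 4) / ((n : ℝ) + 2) * ((n : ℝ) + 2) := by gcongr; norm_num
      _ = δ / ((n : ℝ) + 4) := div_mul_cancel₀ _ (by positivity)
  refine ⟨fun w hw => ?_, ?_⟩
  · rw [Measure.restrict_apply' hmeasAW]
    exact Measure.count_ne_zero ⟨A w, mem_ball.2 (hclose w hw.2), Set.mem_image_of_mem A hw.1⟩
  · rw [Measure.restrict_apply' hmeasAW, Measure.count_eq_zero_iff]
    refine Set.eq_empty_of_forall_notMem ?_
    rintro z ⟨⟨hzball, hzU⟩, ⟨w, hw, rfl⟩⟩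
    have hwn : ‖w‖ ≤ (n : ℝ) + 1 := by
      have : ‖A w‖ ≤ n := mem_closedBall_zero_iff.1 hzball
      rw [A.norm_map] at this
      linarith
    exact hzU (Set.mem_biUnion (show w ∈ {w ∈ W | ‖w‖ ≤ (n : ℝ) + 1} from ⟨hw, hwn⟩)
      (mem_ball.2 (hclose w hwn)))

/-! ## The geometric core: matching along a convergent subsequence identifies the configuration -/

/-- **`HardCore δ ∩ ⋂ₙ ⋃ₘ Eₙ(Dₘ) ⊆ K`, geometric core.**  Let `S`, `W ⊆ ℝ³` be `δ`-separated (`δ > 0`),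
`g : ℕ → O(3)`, `A ∈ O(3)` and `φ` strictly increasing with `g (φ k) → A` uniformly on bounded sets.
If for every `n` each `gₙ w` (`w ∈ W`, `‖w‖ ≤ n+1`) has a point of `S` within `δ/(n+4)` and each
`s ∈ S` with `‖s‖ ≤ n` is within `δ/(n+4)` of some `gₙ w` (`w ∈ W`, `‖w‖ ≤ n+1`), then `S = A(W)`. -/
theorem eq_image_of_matching {δ : ℝ} (hδ : 0 < δ) {W S : Set (EuclideanSpace ℝ (Fin 3))}
    (hW : ∀ x ∈ W, ∀ y ∈ W, x ≠ y → δ ≤ dist x y) (hS : ∀ x ∈ S, ∀ y ∈ S, x ≠ y → δ ≤ dist x y)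
    (g : ℕ → (EuclideanSpace ℝ (Fin 3) →ₗᵢ[ℝ] EuclideanSpace ℝ (Fin 3)))
    (A : EuclideanSpace ℝ (Fin 3) →ₗᵢ[ℝ] EuclideanSpace ℝ (Fin 3)) {φ : ℕ → ℕ} (hφ : StrictMono φ)
    (hconv : ∀ η : ℝ, 0 < η → ∀ᶠ k in atTop, ∀ x, ‖g (φ k) x - A x‖ ≤ η * ‖x‖)
    (E1 : ∀ n : ℕ, ∀ w ∈ W, ‖w‖ ≤ (n : ℝ) + 1 → ∃ s ∈ S, dist s (g n w) < δ / ((n : ℝ) + 4))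
    (E2 : ∀ n : ℕ, ∀ s ∈ S, ‖s‖ ≤ (n : ℝ) →
      ∃ w ∈ W, ‖w‖ ≤ (n : ℝ) + 1 ∧ dist s (g n w) < δ / ((n : ℝ) + 4)) :
    S = A '' W := by
  have hSclosed : IsClosed S :=
    Metric.isClosed_of_pairwise_le_dist hδ fun x hx y hy hxy => hS x hx y hy hxy
  have hεle : ∀ n : ℕ, δ / ((n : ℝ) + 4) ≤ δ / 4 := fun n =>
    div_le_div_of_nonneg_left hδ.le (by norm_num) (by linarith [n.cast_nonneg (α := ℝ)])
  -- along the subsequence, the radii tend to `0` and the windows exhaust space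
  have hεsmall : ∀ η : ℝ, 0 < η → ∀ᶠ k in atTop, δ / ((φ k : ℕ) + 4 : ℝ) < η := by
    intro η hη
    obtain ⟨N, hN⟩ := exists_nat_gt (δ / η)
    refine eventually_atTop.2 ⟨N, fun k hk => ?_⟩
    have hk' : (N : ℝ) ≤ φ k := by exact_mod_cast hk.trans (hφ.id_le k)
    rw [div_lt_iff₀ (by positivity)]
    rw [div_lt_iff₀ hη] at hN
    nlinarith
  have hφge : ∀ R : ℝ, ∀ᶠ k in atTop, R ≤ (φ k : ℝ) := by
    intro R
    obtain ⟨N, hN⟩ := exists_nat_ge R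
    refine eventually_atTop.2 ⟨N, fun k hk => hN.trans ?_⟩
    exact_mod_cast hk.trans (hφ.id_le k)
  -- pointwise control from the uniform-on-bounded-sets convergence
  have hctrl : ∀ (η R : ℝ), 0 < η → 0 ≤ R → ∀ᶠ k in atTop, ∀ x, ‖x‖ ≤ R →
      dist (g (φ k) x) (A x) < η := by
    intro η R hη hR
    filter_upwards [hconv (η / 2 / (R + 1)) (by positivity)] with k hk x hx
    rw [dist_eq_norm]
    calc ‖g (φ k) x - A x‖ ≤ η / 2 / (R + 1) * ‖x‖ := hk x
      _ ≤ η / 2 / (R + 1) * (R + 1) := by gcongr; linarith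
      _ = η / 2 := div_mul_cancel₀ _ (by positivity)
      _ < η := by linarith
  refine Set.Subset.antisymm (fun s hs => ?_) ?_
  · -- `s ∈ S` is a limit of points `A w`, `w` in a FINITE part of `W`
    set W₀ : Set (EuclideanSpace ℝ (Fin 3)) := {w ∈ W | ‖w‖ ≤ ‖s‖ + δ / 4} with hW₀
    have hW₀fin : W₀.Finite :=
      finite_of_forall_le_dist_of_subset_closedBall hδ (fun x hx y hy hxy => hW x hx.1 y hy.1 hxy)
        (c := 0) (R := ‖s‖ + δ / 4) fun w hw => mem_closedBall_zero_iff.2 hw.2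
    have hcl : s ∈ closure (A '' W₀) := by
      rw [Metric.mem_closure_iff]
      intro η hη
      obtain ⟨k, hk1, hk2, hk3⟩ := ((hctrl (η / 2) (‖s‖ + δ / 4) (half_pos hη) (by positivity)).and
        ((hεsmall (η / 2) (half_pos hη)).and (hφge ‖s‖))).exists
      obtain ⟨w, hwW, -, hdist⟩ := E2 (φ k) s hs hk3
      have hwnorm : ‖w‖ ≤ ‖s‖ + δ / 4 := by
        have h1 : ‖g (φ k) w‖ = ‖w‖ := (g (φ k)).norm_map w
        have h2 : ‖g (φ k) w‖ ≤ ‖s‖ + ‖g (φ k) w - s‖ := norm_le_norm_add_norm_sub' _ _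
        rw [← dist_eq_norm, dist_comm] at h2
        linarith [hεle (φ k)]
      refine ⟨A w, Set.mem_image_of_mem A ⟨hwW, hwnorm⟩, ?_⟩
      calc dist s (A w) ≤ dist s (g (φ k) w) + dist (g (φ k) w) (A w) := dist_triangle _ _ _
        _ < η / 2 + η / 2 := add_lt_add (hdist.trans hk2) (hk1 w hwnorm)
        _ = η := by ring
    rw [(hW₀fin.image A).isClosed.closure_eq] at hcl
    exact Set.image_mono (fun w hw => hw.1) hcl
  · -- `A w` (`w ∈ W`) is a limit of points of the closed set `S`
    rintro _ ⟨w, hw, rfl⟩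
    have hcl : A w ∈ closure S := by
      rw [Metric.mem_closure_iff]
      intro η hη
      obtain ⟨k, hk1, hk2, hk3⟩ := ((hctrl (η / 2) ‖w‖ (half_pos hη) (norm_nonneg _)).and
        ((hεsmall (η / 2) (half_pos hη)).and (hφge ‖w‖))).exists
      obtain ⟨s, hsS, hdist⟩ := E1 (φ k) w hw (by linarith)
      refine ⟨s, hsS, ?_⟩
      calc dist (A w) s ≤ dist (A w) (g (φ k) w) + dist (g (φ k) w) s := dist_triangle _ _ _
        _ < η / 2 + η / 2 := by
          refine add_lt_add ?_ ?_
          · rw [dist_comm]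
            exact hk1 w le_rfl
          · rw [dist_comm]
            exact hdist.trans hk2
        _ = η := by ring
    rwa [hSclosed.closure_eq] at hcl

end Summit.AtomisticToContinuum.Crystallization.Theorems.IsometryAtomsMinimisingLawsCohesive.MeasurableClass

end
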